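import Literature.Computability.Cryptography.CubicClassTableSpecs
import Literature.Computability.Cryptography.CubicClassTableProgramSpecs
import Literature.NumberTheory.CubicFields.VoronoiCylinderStep
import Literature.NumberTheory.NumberFields.PureCubicEmbeddings

/-!
# Crux `LinnikCubicClassGroups.PureCubicClassGroupFBQP` (stmt-QuantumAdvantage-11544) — stub `stub_cubicGiantStepCycle`, part RedSem

Line `arakelov-giant-step-cycle`, stub `stub_cubicGiantStepCycle` (S3b-W1), FIRST PART: the semantics of ONE
REDUCTION STEP of the cubic walk, from the named specifications of the programs
(`Literature/Computability/Cryptography/CubicClassTableProgramSpecs.lean`):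

* `val_lexE_eq_of_least` — under `LexMinSpec`, on the canonical code of `J ≠ 0` the value of `lexE` IS any
  element of `J` with least real conjugate in the open unit cylinder (such an element is unique);
* `redL_fst_spec`, `redL_snd_spec` — under `LexMinSpec ∧ InvSpec ∧ ScaleSpec ∧ RedLEq (∧ LogSpec)`:
  `(redL c).1` is the canonical code of `γ⁻¹ J` (`γ` the cylinder minimum) and `(redL c).2` is within `1` of
  `2^prec log σ₁ γ` as soon as `σ₁ γ ≥ 2^-prec` (the real conjugate of an element code is its value at the
  real cube roots, `PureCubic.real_embedding_val`);
* `isBigL_iff_of_specs` — under `IsBigEq`, the big-gap flag is `11/10 ≤ σ₁ γ` (signs are exact in signature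
  `(1,1)`, `norm_nonneg_iff`);
* **`redSem_of_specs`** — the named Prop `CubicClassTable.RedSem` of `CubicClassTableSpecs.lean` for the bundle
  `⟨roots, primeL, latProd, redL, rhoS, starS, unitS⟩` (any `roots, primeL, latProd, rhoS, starS, unitS`), consumed
  by the class-group stage of the line.
-/

-- the problem namespace repeats the summit name (`QuantumAdvantage.QuantumAdvantage`)
set_option linter.dupNamespace false

namespace Summit.QuantumAdvantage.QuantumAdvantage.Theorems.LinnikCubicClassGroups

open scoped NumberField nonZeroDivisors
open Literature.Computability.Cryptography
open Literature.Computability.Cryptography.CubicClassTable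
open Literature.NumberTheory.CubicFields (PureCubicCodes.Mem PureCubicCodes.Canon PureCubicCodes.val norm_nonneg_iff)
open Literature.NumberTheory.NumberFields.PureCubic (real_embedding_val)

section RedSem

variable {K : Type*} [Field K] [NumberField K] {a b : ℕ} {θ : K} {σ₁ : K →+* ℝ} {σ₂ : K →+* ℂ}
  {lexE : (ℕ × ℕ) × (ℕ × List ℤ) → ℤ × ℤ × ℤ × ℕ}
  {logE : (ℕ × ℕ) × ((ℤ × ℤ × ℤ × ℕ) × ℕ) → ℤ}
  {invE : (ℕ × ℕ) × (ℤ × ℤ × ℤ × ℕ) → ℤ × ℤ × ℤ × ℕ}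
  {latScale : (ℕ × ℕ) × ((ℕ × List ℤ) × (ℤ × ℤ × ℤ × ℕ)) → ℕ × List ℤ}
  {redL : ((ℕ × ℕ) × ℕ) × (ℕ × List ℤ) → (ℕ × List ℤ) × ℤ}
  {isBigL : (ℕ × ℕ) × (ℕ × List ℤ) → Bool}

/-- **The value of `lexE` is THE cylinder minimum.** Under `LexMinSpec`, on the canonical code `c` of a nonzero
fractional ideal `J`, `val (lexE c)` equals any `γ ∈ J` of the open unit cylinder with least real conjugate there
(two least elements have the same `σ₁`, and `σ₁` is injective). -/
theorem val_lexE_eq_of_least (hlex : LexMinSpec a b K θ σ₁ σ₂ lexE) {c : ℕ × List ℤ} (hc : PureCubicCodes.Canon c)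
    {J : FractionalIdeal (𝓞 K)⁰ K} (hJ : J ≠ 0) (hcJ : ∀ φ : K, PureCubicCodes.Mem θ b c φ ↔ φ ∈ J)
    {γ : K} (hγJ : γ ∈ J) (hγpos : 0 < σ₁ γ) (hγ1 : ‖σ₂ γ‖ < 1)
    (hγmin : ∀ φ : K, φ ∈ J → 0 < σ₁ φ → ‖σ₂ φ‖ < 1 → σ₁ γ ≤ σ₁ φ) :
    1 ≤ (lexE ((a, b), c)).2.2.2 ∧ PureCubicCodes.val θ b (lexE ((a, b), c)) = γ := by
  obtain ⟨hden, hmem, hpos, hcyl, hmin⟩ := hlex c hc ⟨J, hJ, hcJ⟩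
  refine ⟨hden, σ₁.injective (le_antisymm (hmin γ ((hcJ γ).2 hγJ) hγpos hγ1) ?_)⟩
  exact hγmin _ ((hcJ _).1 hmem) hpos hcyl

/-- **The first component of the reduction step**: under `LexMinSpec`, `InvSpec`, `ScaleSpec`, `RedLEq`, on the
canonical code `c` of `J ≠ 0` with cylinder minimum `γ = val (lexE c)`, `(redL c).1` is canonical and codes
`{φ | φ γ ∈ J} = γ⁻¹ J`. -/
theorem redL_fst_spec (hlex : LexMinSpec a b K θ σ₁ σ₂ lexE) (hinv : InvSpec a b K θ invE)
    (hscale : ScaleSpec a b K θ latScale) (hred : RedLEq a b K θ lexE logE invE latScale redL)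
    (prec : ℕ) {c : ℕ × List ℤ} (hc : PureCubicCodes.Canon c)
    {J : FractionalIdeal (𝓞 K)⁰ K} (hJ : J ≠ 0) (hcJ : ∀ φ : K, PureCubicCodes.Mem θ b c φ ↔ φ ∈ J) :
    PureCubicCodes.Canon (redL (((a, b), prec), c)).1 ∧
      (∀ φ : K, PureCubicCodes.Mem θ b (redL (((a, b), prec), c)).1 φ ↔ φ * PureCubicCodes.val θ b (lexE ((a, b), c)) ∈ J) ∧
      (∀ φ : K, PureCubicCodes.Mem θ b (redL (((a, b), prec), c)).1 φ ↔
        φ ∈ FractionalIdeal.spanSingleton (𝓞 K)⁰ (PureCubicCodes.val θ b (lexE ((a, b), c)))⁻¹ * J) := by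
  obtain ⟨hden, hmem, hpos, -, -⟩ := hlex c hc ⟨J, hJ, hcJ⟩
  set γ : K := PureCubicCodes.val θ b (lexE ((a, b), c)) with hγ
  have hγ0 : γ ≠ 0 := fun h => by rw [h, map_zero] at hpos; exact lt_irrefl _ hpos
  obtain ⟨hden', hinv'⟩ := hinv (lexE ((a, b), c)) hden hγ0
  have hι0 : PureCubicCodes.val θ b (invE ((a, b), lexE ((a, b), c))) ≠ 0 := left_ne_zero_of_mul_eq_one hinv'
  have hιγ : PureCubicCodes.val θ b (invE ((a, b), lexE ((a, b), c))) = γ⁻¹ := eq_inv_of_mul_eq_one_left hinv'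
  obtain ⟨h1, -⟩ := hred prec c hden hγ0
  obtain ⟨hcan, hmemS⟩ := hscale c (invE ((a, b), lexE ((a, b), c))) hc hden' hι0
  have key : ∀ φ : K, PureCubicCodes.Mem θ b (redL (((a, b), prec), c)).1 φ ↔ φ * γ ∈ J := fun φ => by
    rw [h1, hmemS]
    constructor
    · rintro ⟨ψ, hψ, rfl⟩
      rw [hιγ, inv_mul_cancel_right₀ hγ0]
      exact (hcJ ψ).1 hψ
    · intro h
      exact ⟨φ * γ, (hcJ _).2 h, by rw [hιγ, mul_inv_cancel_right₀ hγ0]⟩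
  refine ⟨h1 ▸ hcan, key, fun φ => ?_⟩
  rw [key, FractionalIdeal.mem_singleton_mul]
  constructor
  · intro h
    exact ⟨φ * γ, h, by rw [mul_comm φ γ, ← mul_assoc, inv_mul_cancel₀ hγ0, one_mul]⟩
  · rintro ⟨y, hy, rfl⟩
    rwa [mul_comm γ⁻¹ y, inv_mul_cancel_right₀ hγ0]

/-- **The second component of the reduction step**: under `LexMinSpec`, `RedLEq`, `LogSpec` (and `θ³ = ab²`,
`ab` squarefree, so that the real conjugate of an element code is its value at the real cube roots), on the
canonical code `c` of `J ≠ 0` with cylinder minimum `γ`, `(redL c).2` is within `1` of `2^prec log σ₁ γ` whenever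
`σ₁ γ ≥ 2^-prec`. -/
theorem redL_snd_spec (hab : Squarefree (a * b)) (hθ : θ ^ 3 = ((a * b ^ 2 : ℕ) : K))
    (hlex : LexMinSpec a b K θ σ₁ σ₂ lexE) (hlog : LogSpec a b logE)
    (hred : RedLEq a b K θ lexE logE invE latScale redL)
    (prec : ℕ) {c : ℕ × List ℤ} (hc : PureCubicCodes.Canon c)
    {J : FractionalIdeal (𝓞 K)⁰ K} (hJ : J ≠ 0) (hcJ : ∀ φ : K, PureCubicCodes.Mem θ b c φ ↔ φ ∈ J)
    (hp : (1 : ℝ) / 2 ^ prec ≤ σ₁ (PureCubicCodes.val θ b (lexE ((a, b), c)))) :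
    |((redL (((a, b), prec), c)).2 : ℝ) - 2 ^ prec * Real.log (σ₁ (PureCubicCodes.val θ b (lexE ((a, b), c))))| ≤ 1 := by
  obtain ⟨hden, -, hpos, -, -⟩ := hlex c hc ⟨J, hJ, hcJ⟩
  have hγ0 : PureCubicCodes.val θ b (lexE ((a, b), c)) ≠ 0 := fun h => by
    rw [h, map_zero] at hpos; exact lt_irrefl _ hpos
  obtain ⟨-, h2⟩ := hred prec c hden hγ0
  rw [h2, real_embedding_val σ₁ hab hθ]
  rw [real_embedding_val σ₁ hab hθ] at hp
  exact hlog (lexE ((a, b), c)) prec hden hp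

/-- **The big-gap flag**: under `LexMinSpec` and `IsBigEq`, in signature `(1,1)`, on the canonical code `c` of
`J ≠ 0` with cylinder minimum `γ = val (lexE c)`: `isBigL c = true ↔ 11/10 ≤ σ₁ γ` (`N(10γ − 11) ≥ 0` is the sign
of `σ₁ (10 γ − 11)`). -/
theorem isBigL_iff_of_specs (hdeg : Module.finrank ℚ K = 3) (hσ₂ : ∃ z : K, starRingEnd ℂ (σ₂ z) ≠ σ₂ z)
    (hlex : LexMinSpec a b K θ σ₁ σ₂ lexE) (hbig : IsBigEq a b K θ lexE isBigL)
    {c : ℕ × List ℤ} (hc : PureCubicCodes.Canon c)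
    {J : FractionalIdeal (𝓞 K)⁰ K} (hJ : J ≠ 0) (hcJ : ∀ φ : K, PureCubicCodes.Mem θ b c φ ↔ φ ∈ J) :
    isBigL ((a, b), c) = true ↔ (11 : ℝ) / 10 ≤ σ₁ (PureCubicCodes.val θ b (lexE ((a, b), c))) := by
  obtain ⟨hden, -, -, -, -⟩ := hlex c hc ⟨J, hJ, hcJ⟩
  rw [hbig c hden, norm_nonneg_iff hdeg hσ₂ σ₁, map_sub, map_mul, map_ofNat, map_ofNat, sub_nonneg,
    div_le_iff₀' (by norm_num : (0 : ℝ) < 10)]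

/-- **One reduction step, semantically** (the named Prop `CubicClassTable.RedSem` of
`Literature/Computability/Cryptography/CubicClassTableSpecs.lean`): for `θ³ = ab²` (`ab` squarefree) in a number
field `K` with embeddings `σ₁` (real) and `σ₂`, the specifications `LexMinSpec` (G2), `LogSpec` (G3), `InvSpec`,
`ScaleSpec` (G1) and the operational equation `RedLEq` (P4) imply: on the canonical code of `J ≠ 0`, `redL` divides by
the cylinder minimum `γ` (the result codes `γ⁻¹ J`) and returns a `2^prec`-scaled logarithm of `σ₁ γ` certified to
`±1` whenever `σ₁ γ ≥ 2^-prec`. The other programs of the bundle (`roots, primeL, latProd, rhoS, starS, unitS`) are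
arbitrary. -/
theorem redSem_of_specs : ∀ (a b : ℕ), Squarefree (a * b) →
    ∀ (K : Type) [Field K] [NumberField K] (θ : K), θ ^ 3 = ((a * b ^ 2 : ℕ) : K) →
    ∀ (σ₁ : K →+* ℝ) (σ₂ : K →+* ℂ)
      (lexE : (ℕ × ℕ) × (ℕ × List ℤ) → ℤ × ℤ × ℤ × ℕ) (logE : (ℕ × ℕ) × ((ℤ × ℤ × ℤ × ℕ) × ℕ) → ℤ)
      (invE : (ℕ × ℕ) × (ℤ × ℤ × ℤ × ℕ) → ℤ × ℤ × ℤ × ℕ)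
      (latScale : (ℕ × ℕ) × ((ℕ × List ℤ) × (ℤ × ℤ × ℤ × ℕ)) → ℕ × List ℤ)
      (latProd : (ℕ × ℕ) × ((ℕ × List ℤ) × (ℕ × List ℤ)) → ℕ × List ℤ)
      (redL : ((ℕ × ℕ) × ℕ) × (ℕ × List ℤ) → (ℕ × List ℤ) × ℤ)
      (rhoS : ((ℕ × ℕ) × ℕ) × (ℕ × List ℤ) → (ℕ × List ℤ) × ℤ)
      (starS : ((ℕ × ℕ) × ℕ) × ((ℕ × List ℤ) × (ℕ × List ℤ)) → (ℕ × List ℤ) × ℤ)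
      (unitS : (ℕ × ℕ) × ℕ → (ℕ × List ℤ) × ℤ)
      (roots : ℕ × ℕ × List Bool → List ℕ) (primeL : (ℕ × ℕ) × ((ℕ × List ℤ) × (ℕ × ℕ)) → ℕ × List ℤ),
    CubicClassTable.LexMinSpec a b K θ σ₁ σ₂ lexE → CubicClassTable.LogSpec a b logE → CubicClassTable.InvSpec a b K θ invE → CubicClassTable.ScaleSpec a b K θ latScale →
    CubicClassTable.RedLEq a b K θ lexE logE invE latScale redL →
    CubicClassTable.RedSem ⟨roots, primeL, latProd, redL, rhoS, starS, unitS⟩ a b K θ σ₁ σ₂ := by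
  intro a b hab K _ _ θ hθ σ₁ σ₂ lexE logE invE latScale latProd redL rhoS starS unitS roots primeL hlex hlog hinv hscale
    hred prec c J hJ hc hcJ
  obtain ⟨-, hmem, hpos, hcyl, hmin⟩ := hlex c hc ⟨J, hJ, hcJ⟩
  obtain ⟨hcan, hmemR, -⟩ := redL_fst_spec hlex hinv hscale hred prec hc hJ hcJ
  exact ⟨PureCubicCodes.val θ b (lexE ((a, b), c)), (hcJ _).1 hmem, hpos, hcyl,
    fun φ hφ => hmin φ ((hcJ φ).2 hφ), hcan, hmemR,
    fun hp => redL_snd_spec hab hθ hlex hlog hred prec hc hJ hcJ hp⟩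

end RedSem

end Summit.QuantumAdvantage.QuantumAdvantage.Theorems.LinnikCubicClassGroups
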